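import Summits.QuantumFields.YangMills.Theses.CovariantCurrentDoor
import Summits.QuantumFields.YangMills.Theorems.FemtoTransferGapBounds
import Summits.QuantumFields.YangMills.Theorems.FemtoTransferGapSlabRayleigh
import HarnessLib

/-!
# `CovariantCurrentDoor.CurrentDoor` (item stmt-QuantumFields-23382) — PROVED:
# CurrentCommutatorCeiling → CurrentNormFloor → the ∃-window current bound `2L·D(X) ≤ λ₀‖XΩ‖²`, `‖XΩ‖² > 0`

Route `CovariantCurrentDoor` (D-0145 LINE g17-B of seat ym-idea-4; draft-by-design onto K2a).  Pure real arithmetic: with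
`(a₁, κ, C, k₁)` from the commutator ceiling `D ≤ C L^{k₁} β^{−κ} λ₀` and `(a₂, c, k₂)` from the floor `c L^{−k₂} ≤ ‖XΩ‖²`, put
`C' = max C 0`, `K = max k₁ 0 + max k₂ 0 + 1`, `a = min(a₁, a₂, κ/(2K))`; on `L ≤ β^a`, `2C'L^{1+k₁+k₂}β^{−κ} ≤ 2C'β^{−κ/2} ≤ c` once
`β^{κ/2} ≥ 2C'/c` (`tendsto_rpow_atTop`), hence `2L·D ≤ λ₀ c L^{−k₂} ≤ λ₀‖XΩ‖²` (`λ₀ > 0`).  Arithmetic core `current_door_arith`.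

HONEST FRAMING: bookkeeping; both cruxes are OPEN hypotheses; K2a, R2ξ″ and the YM mass gap are NOT proved.  No `sorry`, no new axiom,
no new definition.  References: [cite: ReedSimonIV1978, Thm. XIII.1].
-/

set_option autoImplicit false

noncomputable section

open MeasureTheory Filter Topology Real
open Literature.MathematicalPhysics.QuantumFieldTheory (GaugeConfig Site gaugeTransform)

namespace Summit.QuantumFields.YangMills.Theorems.CovariantCurrentDoor

open Summit.QuantumFields.YangMills.Theorems.FemtoTransferGap

/-! ## §1 The arithmetic core -/

/-- **Current-door arithmetic**: ceiling `D ≤ C'L^{k₁}β^{−κ}T`, floor `cL^{−k₂} ≤ N`, window `1 ≤ L ≤ β^a`, `aK ≤ κ/2`, `1 + k₁ + k₂ ≤ K`,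
`0 ≤ K`, threshold `2C' ≤ cβ^{κ/2}` ⇒ `2L·D ≤ T·N` and `0 < N` (`T, c > 0`, `C' ≥ 0`, `β ≥ 1`). [cite: ReedSimonIV1978, Thm. XIII.1] -/
theorem current_door_arith {D N T C' c β Lr k₁ k₂ K a κ : ℝ} (hT : 0 < T) (hc : 0 < c) (hC' : 0 ≤ C') (hβ : 1 ≤ β)
    (hL : 1 ≤ Lr) (hLa : Lr ≤ β ^ a) (haK : a * K ≤ κ / 2) (hK : 1 + k₁ + k₂ ≤ K) (hK0 : 0 ≤ K)
    (hceil : D ≤ C' * Lr ^ k₁ * β ^ (-κ) * T) (hfloor : c * Lr ^ (-k₂) ≤ N) (hbig : 2 * C' ≤ c * β ^ (κ / 2)) :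
    2 * Lr * D ≤ T * N ∧ 0 < N := by
  have hβ0 : 0 < β := by linarith
  have hL0 : 0 < Lr := by linarith
  have hN : 0 < N := lt_of_lt_of_le (mul_pos hc (Real.rpow_pos_of_pos hL0 _)) hfloor
  refine ⟨?_, hN⟩
  -- `L^{1+k₁+k₂} ≤ β^{κ/2}`
  have hLK : Lr ^ (1 + k₁ + k₂) ≤ β ^ (κ / 2) := by
    calc Lr ^ (1 + k₁ + k₂) ≤ Lr ^ K := Real.rpow_le_rpow_of_exponent_le hL hK
      _ ≤ (β ^ a) ^ K := Real.rpow_le_rpow hL0.le hLa hK0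
      _ = β ^ (a * K) := (Real.rpow_mul hβ0.le a K).symm
      _ ≤ β ^ (κ / 2) := Real.rpow_le_rpow_of_exponent_le hβ haK
  -- `2C' L^{1+k₁} β^{−κ} ≤ c L^{−k₂}`
  have hkey : 2 * C' * (Lr * Lr ^ k₁) * β ^ (-κ) ≤ c * Lr ^ (-k₂) := by
    have hsplit : Lr * Lr ^ k₁ = Lr ^ (1 + k₁ + k₂) * Lr ^ (-k₂) := by
      rw [← Real.rpow_add hL0, show 1 + k₁ + k₂ + -k₂ = 1 + k₁ by ring, Real.rpow_add hL0, Real.rpow_one]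
    have hβsplit : β ^ (κ / 2) * β ^ (-κ) = β ^ (-(κ / 2)) := by
      rw [← Real.rpow_add hβ0]; ring_nf
    have hcc : c = c * β ^ (κ / 2) * β ^ (-(κ / 2)) := by
      rw [mul_assoc, ← Real.rpow_add hβ0]; simp
    have h0 : 0 ≤ Lr ^ (-k₂) := Real.rpow_nonneg hL0.le _
    have h1 : 0 ≤ β ^ (-(κ / 2)) := Real.rpow_nonneg hβ0.le _
    calc 2 * C' * (Lr * Lr ^ k₁) * β ^ (-κ) = 2 * C' * (Lr ^ (1 + k₁ + k₂) * β ^ (-κ)) * Lr ^ (-k₂) := by rw [hsplit]; ring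
      _ ≤ 2 * C' * (β ^ (κ / 2) * β ^ (-κ)) * Lr ^ (-k₂) := by
          have := mul_le_mul_of_nonneg_right hLK (Real.rpow_nonneg hβ0.le (-κ))
          have h2 : 0 ≤ 2 * C' := by linarith
          exact mul_le_mul_of_nonneg_right (mul_le_mul_of_nonneg_left this h2) h0
      _ = 2 * C' * β ^ (-(κ / 2)) * Lr ^ (-k₂) := by rw [hβsplit]
      _ ≤ c * β ^ (κ / 2) * β ^ (-(κ / 2)) * Lr ^ (-k₂) :=
          mul_le_mul_of_nonneg_right (mul_le_mul_of_nonneg_right hbig h1) h0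
      _ = c * Lr ^ (-k₂) := by rw [← hcc]
  calc 2 * Lr * D ≤ 2 * Lr * (C' * Lr ^ k₁ * β ^ (-κ) * T) := mul_le_mul_of_nonneg_left hceil (by linarith)
    _ = (2 * C' * (Lr * Lr ^ k₁) * β ^ (-κ)) * T := by ring
    _ ≤ (c * Lr ^ (-k₂)) * T := mul_le_mul_of_nonneg_right hkey hT.le
    _ ≤ N * T := mul_le_mul_of_nonneg_right hfloor hT.le
    _ = T * N := mul_comm _ _

/-! ## §2 The door -/

/-- ★ **`CurrentDoor`** (item stmt-QuantumFields-23382): `CurrentCommutatorCeiling → CurrentNormFloor →` on an ∃-window `L ≤ β^a`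
(`a = min(a₁, a₂, κ/(2K))`, `K = max k₁ 0 + max k₂ 0 + 1`) every normalised physical exact ground state has `2L·D(X) ≤ λ₀‖XΩ‖²` and
`‖XΩ‖² > 0`. [cite: ReedSimonIV1978, Thm. XIII.1] -/
theorem currentDoor_proof : Summit.QuantumFields.YangMills.Theses.CovariantCurrentDoor.CurrentDoor := by
  intro h1 h2
  obtain ⟨a₁, κ, C, k₁, ha₁, hκ, b₁, l₁, H1⟩ := h1
  obtain ⟨a₂, c, k₂, ha₂, hc, b₂, l₂, H2⟩ := h2
  set C' : ℝ := max C 0 with hC'_def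
  have hC'0 : 0 ≤ C' := le_max_right _ _
  set K : ℝ := max k₁ 0 + max k₂ 0 + 1 with hK_def
  have hK1 : 1 ≤ K := by
    have := le_max_right k₁ 0; have := le_max_right k₂ 0; linarith
  have hKle : 1 + k₁ + k₂ ≤ K := by
    have := le_max_left k₁ 0; have := le_max_left k₂ 0; linarith
  set a : ℝ := min (min a₁ a₂) (κ / (2 * K)) with ha_def
  have hapos : 0 < a := lt_min (lt_min ha₁ ha₂) (div_pos hκ (by linarith))
  have haa₁ : a ≤ a₁ := (min_le_left _ _).trans (min_le_left _ _)
  have haa₂ : a ≤ a₂ := (min_le_left _ _).trans (min_le_right _ _)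
  have haK : a * K ≤ κ / 2 := by
    have h := min_le_right (min a₁ a₂) (κ / (2 * K))
    have hK0 : 0 < K := by linarith
    calc a * K ≤ κ / (2 * K) * K := mul_le_mul_of_nonneg_right h hK0.le
      _ = κ / 2 := by field_simp
  -- threshold `2C' ≤ c β^{κ/2}`
  have hev : ∀ᶠ β : ℝ in atTop, 2 * C' ≤ c * β ^ (κ / 2) :=
    ((tendsto_rpow_atTop (by linarith : (0 : ℝ) < κ / 2)).const_mul_atTop hc).eventually_ge_atTop _
  obtain ⟨b₃, hb₃⟩ := Filter.eventually_atTop.mp hev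
  refine ⟨a, hapos, max (max b₁ b₂) (max b₃ 1), max l₁ l₂, ?_⟩
  intro β hβ L _ hL hLa Ω hΩ hn heig
  have hb₁' : b₁ ≤ β := le_trans (le_trans (le_max_left _ _) (le_max_left _ _)) hβ
  have hb₂' : b₂ ≤ β := le_trans (le_trans (le_max_right _ _) (le_max_left _ _)) hβ
  have hb₃' : b₃ ≤ β := le_trans (le_trans (le_max_left _ _) (le_max_right _ _)) hβ
  have hβ1 : (1 : ℝ) ≤ β := le_trans (le_trans (le_max_right _ _) (le_max_right _ _)) hβ
  have hβ0 : 0 < β := by linarith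
  have hl₁ : l₁ ≤ L := le_trans (le_max_left _ _) hL
  have hl₂ : l₂ ≤ L := le_trans (le_max_right _ _) hL
  have hL1 : (1 : ℝ) ≤ L := by exact_mod_cast NeZero.one_le
  have hLa₁ : (L : ℝ) ≤ β ^ a₁ := hLa.trans (Real.rpow_le_rpow_of_exponent_le hβ1 haa₁)
  have hLa₂ : (L : ℝ) ≤ β ^ a₂ := hLa.trans (Real.rpow_le_rpow_of_exponent_le hβ1 haa₂)
  have H1' := H1 β hb₁' L hl₁ hLa₁ Ω hΩ hn heig
  have H2' := H2 β hb₂' L hl₂ hLa₂ Ω hΩ hn heig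
  dsimp only at H1' H2' ⊢
  have hT := topValue_su2Rep_pos L β
  -- ceiling with `C'`
  have hX0 : 0 ≤ (L : ℝ) ^ k₁ * β ^ (-κ) * topValue su2Rep L β := by positivity
  have hCle : C * ((L : ℝ) ^ k₁ * β ^ (-κ) * topValue su2Rep L β) ≤ C' * ((L : ℝ) ^ k₁ * β ^ (-κ) * topValue su2Rep L β) :=
    mul_le_mul_of_nonneg_right (le_max_left C 0) hX0
  have H1'' := H1'.trans (by linarith [hCle] : C * (L : ℝ) ^ k₁ * β ^ (-κ) * topValue su2Rep L β ≤
    C' * (L : ℝ) ^ k₁ * β ^ (-κ) * topValue su2Rep L β)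
  exact current_door_arith hT hc hC'0 hβ1 hL1 hLa haK hKle (by linarith) H1'' H2' (hb₃ β hb₃')

end Summit.QuantumFields.YangMills.Theorems.CovariantCurrentDoor

end
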